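import Summits.RiemannHypothesis.RiemannHypothesis.Theorems.HandoffDodgerHorizonChoice
import HarnessLib

/-!
# HANDOFF — CUMULANTS FROM COUNTING (ATTEMPT-16 Lemma B3, kernel form): `S⁰_j ≤ j·T₀^{2j+1}/(π(2j+1)²) + s·T^{2j}` (rh-explicit, W-P(P2) crux 19185, seat dodger-p2 gen0; DODGER-STAGE2-PLAN §2 (c) brick B3-i)

RH-FREE. HONEST FRAMING: nothing here bears on the truth of RH; this is zero COUNTING plus calculus. gen10's
`HandoffDodgerPowerSums.ordinatePowerSum_le` bounds the ordinate power sums `S⁰_j = Σ_ρ m(ρ)γ_ρ^{2j} − Σ_{k<K} ℓ_{k+1}^{2j}` of the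
killed configuration (`K = N(T)`, lattice `ℓ_k = πk/b`, clean horizon `N ≤ Λ_K` on `[0,T]`) by `j·T^{2(j−1)}·S⁰_1`, i.e. it bounds
`t^{2j−1} ≤ T^{2j−2}·t` under the tree's layer-cake identity `HandoffDodgerMoments.sum_zeros_pow_sub_sum_lattice_pow`
(`S⁰_j = −∫₀ᵀ (N − Λ_K)·2j t^{2j−1} dt`). ATTEMPT-16 Lemma B3 integrates instead against the COUNTING bound of the deficit,
`Λ_K(t) − N(t) ≤ (t/2π)·log(T₀/t) + s` (`T₀ = 2πe^{1+2b}`, `s = s₁(T₀)` the Hasanalizade–Shen–Wong constant; `latticeCount_sub_count_le`,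
from the tree theorem `zetaZeroCount_hasanalizade_shen_wong_holds`), with the exact moment `∫₀^{T₀} t^{2j} log(T₀/t) dt = T₀^{2j+1}/(2j+1)²`
(`integral_pow_mul_log_div_le`). RESULT (**`ordinatePowerSum_le_counting`**, **`norm_dodgerPowerSum_le_counting`**):

  `S⁰_j ≤ j·T₀^{2j+1}/(π(2j+1)²) + s·T^{2j}`,  `‖S_j‖ ≤ j·T₀^{2j+1}/(π(2j+1)²) + s·T^{2j} + j·W^{j−1}·(T+¼)·K`  (`W = T² + ¼`),

which is `≈ 9/(2j+1)²` of the geometric bound `j·W^{j−1}·P` at each `j ≥ 2` — the input that moves the profile-control exponent of the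
dodger chain from `≈ 56.6N₁²/T′` to `≈ 10N₁²/T′` (DODGER-STAGE2-PLAN §2 (c): MODEL floor of the explicit chain ≈ 950 instead of ≈ 7 000).
No `sorry`, standard axioms, no definitions.

References: this track (ATTEMPT-16 §3 Lemma B3; ATTEMPT-19 §3; HOME/rh-explicit-dodger-p2/DODGER-STAGE2-PLAN.md §2).
-/

set_option linter.dupNamespace false

noncomputable section

open Real Set MeasureTheory intervalIntegral

namespace Summit.RiemannHypothesis.RiemannHypothesis.Theorems.Handoff

open Literature.NumberTheory.LFunctions Literature.NumberTheory.LFunctions.SchoenfeldBound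
open scoped Real

/-! ## Calculus: `∫₀ᵀ tⁿ log(T₀/t) dt ≤ T₀^{n+1}/(n+1)²` -/

/-- `tⁿ·log(T₀/t) = t^{n−1}·(t·log T₀ − t·log t)` for all real `t` (`n ≥ 1`, `T₀ > 0`); the right side is continuous. [folklore] -/
theorem pow_mul_log_div_eq {T₀ : ℝ} (hT₀ : 0 < T₀) {n : ℕ} (hn : 1 ≤ n) (t : ℝ) :
    t ^ n * Real.log (T₀ / t) = t ^ (n - 1) * (t * Real.log T₀ - t * Real.log t) := by
  rcases eq_or_ne t 0 with h0 | h0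
  · subst h0
    have : n ≠ 0 := by omega
    simp [zero_pow this]
  · rw [Real.log_div hT₀.ne' h0]
    have e : t ^ n = t ^ (n - 1) * t := by
      rw [← pow_succ]; congr 1; omega
    rw [e]; ring

/-- Continuity of `t ↦ tⁿ·log(T₀/t)` (`n ≥ 1`, `T₀ > 0`). [folklore] -/
theorem continuous_pow_mul_log_div {T₀ : ℝ} (hT₀ : 0 < T₀) {n : ℕ} (hn : 1 ≤ n) :
    Continuous fun t : ℝ => t ^ n * Real.log (T₀ / t) := by
  have e : (fun t : ℝ => t ^ n * Real.log (T₀ / t)) = fun t => t ^ (n - 1) * (t * Real.log T₀ - t * Real.log t) := by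
    funext t; exact pow_mul_log_div_eq hT₀ hn t
  rw [e]
  exact (continuous_pow _).mul ((continuous_id.mul continuous_const).sub Real.continuous_mul_log)

/-- **The log-moment.** For `0 ≤ T ≤ T₀`, `n ≥ 1`: `∫₀ᵀ tⁿ·log(T₀/t) dt ≤ T₀^{n+1}/(n+1)²` (the integrand is `≥ 0` on `[0, T₀]` and
`∫₀^{T₀} tⁿ log(T₀/t) dt = T₀^{n+1}/(n+1)²`). [folklore; ATTEMPT-16 §3 Lemma B3 (iv)] -/
theorem integral_pow_mul_log_div_le {T₀ T : ℝ} (hT₀ : 0 < T₀) (hT : 0 ≤ T) (hTT₀ : T ≤ T₀) {n : ℕ} (hn : 1 ≤ n) :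
    ∫ t in (0 : ℝ)..T, t ^ n * Real.log (T₀ / t) ≤ T₀ ^ (n + 1) / ((n : ℝ) + 1) ^ 2 := by
  have hcont := continuous_pow_mul_log_div hT₀ hn
  -- nonnegativity on `[0, T₀]`
  have hnn : ∀ t, t ∈ Set.Ioc (0 : ℝ) T₀ → 0 ≤ t ^ n * Real.log (T₀ / t) := by
    intro t ht
    refine mul_nonneg (pow_nonneg ht.1.le _) (Real.log_nonneg ?_)
    rw [le_div_iff₀ ht.1]; linarith [ht.2]
  -- `∫₀ᵀ ≤ ∫₀^{T₀}`
  have hmono : ∫ t in (0 : ℝ)..T, t ^ n * Real.log (T₀ / t) ≤ ∫ t in (0 : ℝ)..T₀, t ^ n * Real.log (T₀ / t) := by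
    refine intervalIntegral.integral_mono_interval le_rfl hT hTT₀ ?_ (hcont.intervalIntegrable _ _)
    rw [Filter.EventuallyLE, ae_restrict_iff' measurableSet_Ioc]
    exact Filter.Eventually.of_forall hnn
  -- the primitive `G(t) = (t^{n+1} log T₀ − t^{n}·(t log t))/(n+1) + t^{n+1}/(n+1)²`
  set G : ℝ → ℝ := fun t => (t ^ (n + 1) * Real.log T₀ - t ^ n * (t * Real.log t)) / ((n : ℝ) + 1) +
    t ^ (n + 1) / ((n : ℝ) + 1) ^ 2 with hG
  have hn1 : (0 : ℝ) < (n : ℝ) + 1 := by positivity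
  have hGcont : Continuous G := by
    simp only [hG]
    exact ((((continuous_pow _).mul continuous_const).sub ((continuous_pow _).mul Real.continuous_mul_log)).div_const _).add
      ((continuous_pow _).div_const _)
  have hderiv : ∀ t ∈ Set.Ioo (0 : ℝ) T₀, HasDerivAt G (t ^ n * Real.log (T₀ / t)) t := by
    intro t ht
    have ht0 : 0 < t := ht.1
    -- derivative of `t^{n+1}`
    have h1 : HasDerivAt (fun u : ℝ => u ^ (n + 1)) (((n : ℝ) + 1) * t ^ n) t := by
      have := hasDerivAt_pow (n + 1) t
      simpa using this
    -- derivative of `t^n · (t log t) = t^{n+1} log t`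
    have h2 : HasDerivAt (fun u : ℝ => u ^ n * (u * Real.log u)) (((n : ℝ) + 1) * t ^ n * Real.log t + t ^ n) t := by
      have hl : HasDerivAt (fun u : ℝ => u * Real.log u) (Real.log t + 1) t := Real.hasDerivAt_mul_log ht0.ne'
      have hp : HasDerivAt (fun u : ℝ => u ^ n) ((n : ℝ) * t ^ (n - 1)) t := by
        simpa using hasDerivAt_pow n t
      have h := hp.mul hl
      refine h.congr_deriv ?_
      have e : t ^ n = t ^ (n - 1) * t := by rw [← pow_succ]; congr 1; omega
      rw [e]; ring
    have h3 := ((h1.mul_const (Real.log T₀)).sub h2).div_const ((n : ℝ) + 1)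
    have h4 := h1.div_const (((n : ℝ) + 1) ^ 2)
    have h5 := h3.add h4
    refine h5.congr_deriv ?_
    rw [Real.log_div hT₀.ne' ht0.ne']
    field_simp
    ring
  have hFTC := intervalIntegral.integral_eq_sub_of_hasDerivAt_of_le hT₀.le hGcont.continuousOn hderiv
    (hcont.intervalIntegrable _ _)
  have hG0 : G 0 = 0 := by
    simp only [hG]
    have : n + 1 ≠ 0 := by omega
    have : n ≠ 0 := by omega
    simp [zero_pow ‹n + 1 ≠ 0›, zero_pow ‹n ≠ 0›]
  have hGT : G T₀ = T₀ ^ (n + 1) / ((n : ℝ) + 1) ^ 2 := by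
    simp only [hG]
    have e : T₀ ^ n * (T₀ * Real.log T₀) = T₀ ^ (n + 1) * Real.log T₀ := by rw [pow_succ]; ring
    rw [e, sub_self, zero_div, zero_add]
  rw [hFTC, hG0, hGT, sub_zero] at hmono
  exact hmono

/-! ## The counting bound of the deficit -/

/-- **The deficit from above (HSW).** With `T₀ = 2πe^{1+2b}` (`b ≥ 1`) and `s := s₁(T₀) = 0.1038 log T₀ + 0.2573 log log T₀ + 9.3675`:
for `0 ≤ t ≤ T₀` and any `K`, `min(⌊bt/π⌋, K) − N(t) ≤ (t/2π)·log(T₀/t) + s` (for `t ≤ 2πe`: `bt/π ≤ (t/2π)log(T₀/t)` and `N ≥ 0`;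
for `t ≥ e`: `N(t) ≥ (t/2π)log(t/2πe) − s₁(t)` by `zetaZeroCount_hasanalizade_shen_wong_holds` and `s₁(t) ≤ s₁(T₀)`).
[this track, ATTEMPT-16 §3 Lemma B3 (iii); HSW 2022 Cor. 1.2 via the tree] -/
theorem latticeCount_sub_count_le {b T₀ t : ℝ} {K : ℕ} (hb : 1 ≤ b) (hT₀ : T₀ = 2 * π * Real.exp (1 + 2 * b))
    (ht0 : 0 ≤ t) (htT₀ : t ≤ T₀) :
    ((min ⌊b * t / π⌋₊ K : ℕ) : ℝ) - (zetaZeroCount t : ℝ) ≤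
      t / (2 * π) * Real.log (T₀ / t) + (0.1038 * Real.log (T₀) + 0.2573 * Real.log (Real.log (T₀)) + 9.3675) := by
  obtain ⟨hT₀e, hT₀pos, -, -, hs1, -⟩ := horizonT₀_facts hb hT₀
  have hb0 : 0 < b := by linarith
  have hπ := Real.pi_pos
  have hN0 : (0 : ℝ) ≤ zetaZeroCount t := Nat.cast_nonneg _
  have hmin : ((min ⌊b * t / π⌋₊ K : ℕ) : ℝ) ≤ b * t / π := by
    have h1 : ((min ⌊b * t / π⌋₊ K : ℕ) : ℝ) ≤ ((⌊b * t / π⌋₊ : ℕ) : ℝ) := by exact_mod_cast min_le_left _ _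
    exact h1.trans (Nat.floor_le (by positivity))
  rcases eq_or_lt_of_le ht0 with ht00 | htpos
  · rw [← ht00]; simp; linarith
  have hmain := main_eq_lattice_sub_deficit (b := b) htpos
  rw [← hT₀] at hmain
  -- `bt/π = N_sm(t) + f(t)`
  rcases le_or_gt t (2 * π * Real.exp 1) with hsmall | hlarge
  · -- `N_sm(t) ≤ 0`
    have hsm : t / (2 * π) * Real.log (t / (2 * π * Real.exp 1)) ≤ 0 := by
      have h1 : Real.log (t / (2 * π * Real.exp 1)) ≤ 0 :=
        Real.log_nonpos (by positivity) (by rw [div_le_one (by positivity)]; exact hsmall)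
      exact mul_nonpos_of_nonneg_of_nonpos (by positivity) h1
    linarith
  · have hte : Real.exp 1 ≤ t := by
      have : Real.exp 1 ≤ 2 * π * Real.exp 1 := by nlinarith [Real.exp_pos 1, Real.pi_gt_three]
      linarith
    have hHSW := (abs_le.1 (zetaZeroCount_hasanalizade_shen_wong_holds t hte)).1
    have hmono := hswErr_mono hte htT₀
    linarith

/-! ## The cumulant bounds -/

/-- **`S⁰_j ≤ j·T₀^{2j+1}/(π(2j+1)²) + s·T^{2j}`** under the clean horizon and the counting bound of the deficit
(`Λ_K − N ≤ (t/2π)log(T₀/t) + s` on `[0, T]`, `T ≤ T₀`). [this track, ATTEMPT-16 §3 Lemma B3 (iv)] -/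
theorem ordinatePowerSum_le_counting {b T T₀ s : ℝ} (hb : 0 < b) (hT : 0 ≤ T) (hK : π * (zetaZeroCount T) / b ≤ T)
    (hT₀ : 0 < T₀) (hTT₀ : T ≤ T₀)
    (hcount : ∀ t ∈ Set.Icc 0 T, ((min ⌊b * t / π⌋₊ (zetaZeroCount T) : ℕ) : ℝ) - (zetaZeroCount t : ℝ) ≤
      t / (2 * π) * Real.log (T₀ / t) + s)
    {j : ℕ} (hj : 1 ≤ j) :
    (∑ ρ ∈ zerosBetween 0 T, (riemannZetaZeroOrder ρ : ℝ) * ρ.im ^ (2 * j)) -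
        ∑ k ∈ Finset.range (zetaZeroCount T), (π * ((k + 1 : ℕ) : ℝ) / b) ^ (2 * j) ≤
      (j : ℝ) * T₀ ^ (2 * j + 1) / (π * (2 * (j : ℝ) + 1) ^ 2) + s * T ^ (2 * j) := by
  rw [sum_zeros_pow_sub_sum_lattice_pow hb hT (by omega) hK, ← intervalIntegral.integral_neg]
  have hN : IntervalIntegrable (fun t : ℝ => (zetaZeroCount t : ℝ)) volume 0 T :=
    Monotone.intervalIntegrable fun s t hst => by exact_mod_cast zetaZeroCount_mono hst
  have hΛ : IntervalIntegrable (fun t : ℝ => (((min ⌊b * t / π⌋₊ (zetaZeroCount T) : ℕ) : ℝ))) volume 0 T := by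
    refine Monotone.intervalIntegrable fun s t hst => ?_
    exact_mod_cast min_le_min_right _ (Nat.floor_le_floor (by
      exact div_le_div_of_nonneg_right (mul_le_mul_of_nonneg_left hst hb.le) Real.pi_pos.le))
  have hg1 : Continuous fun t : ℝ => ((2 * j : ℕ) : ℝ) * t ^ (2 * j - 1) := by fun_prop
  -- the dominating function `(f(t) + s)·(2j t^{2j−1}) = (j/π)·t^{2j} log(T₀/t) + 2js·t^{2j−1}`
  have hdom_eq : ∀ t : ℝ, (t / (2 * π) * Real.log (T₀ / t) + s) * (((2 * j : ℕ) : ℝ) * t ^ (2 * j - 1)) =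
      (j : ℝ) / π * (t ^ (2 * j) * Real.log (T₀ / t)) + 2 * (j : ℝ) * s * t ^ (2 * j - 1) := by
    intro t
    have e : t * t ^ (2 * j - 1) = t ^ (2 * j) := by
      rw [← pow_succ']; congr 1; omega
    push_cast
    have hπ0 : π ≠ 0 := Real.pi_pos.ne'
    field_simp
    rw [← e]; ring
  have hcont2 := continuous_pow_mul_log_div hT₀ (show 1 ≤ 2 * j by omega)
  have hdom_cont : Continuous fun t : ℝ => (j : ℝ) / π * (t ^ (2 * j) * Real.log (T₀ / t)) + 2 * (j : ℝ) * s * t ^ (2 * j - 1) := by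
    fun_prop
  have hdom_int : IntervalIntegrable (fun t : ℝ => (t / (2 * π) * Real.log (T₀ / t) + s) * (((2 * j : ℕ) : ℝ) * t ^ (2 * j - 1)))
      volume 0 T := by
    have e : (fun t : ℝ => (t / (2 * π) * Real.log (T₀ / t) + s) * (((2 * j : ℕ) : ℝ) * t ^ (2 * j - 1))) =
        fun t => (j : ℝ) / π * (t ^ (2 * j) * Real.log (T₀ / t)) + 2 * (j : ℝ) * s * t ^ (2 * j - 1) := by
      funext t; exact hdom_eq t
    rw [e]; exact hdom_cont.intervalIntegrable _ _
  -- pointwise domination on `[0, T]`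
  have hle : ∫ t in (0 : ℝ)..T, -(((zetaZeroCount t : ℝ) - ((min ⌊b * t / π⌋₊ (zetaZeroCount T) : ℕ) : ℝ)) *
        (((2 * j : ℕ) : ℝ) * t ^ (2 * j - 1))) ≤
      ∫ t in (0 : ℝ)..T, (t / (2 * π) * Real.log (T₀ / t) + s) * (((2 * j : ℕ) : ℝ) * t ^ (2 * j - 1)) := by
    refine intervalIntegral.integral_mono_on hT ((hN.sub hΛ).mul_continuousOn hg1.continuousOn).neg hdom_int fun t ht => ?_
    have hw : (0 : ℝ) ≤ ((2 * j : ℕ) : ℝ) * t ^ (2 * j - 1) := by have := ht.1; positivity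
    have hc := hcount t ht
    rw [← neg_mul]
    exact mul_le_mul_of_nonneg_right (by linarith) hw
  refine hle.trans ?_
  -- evaluate the dominating integral
  have e1 : ∫ t in (0 : ℝ)..T, (t / (2 * π) * Real.log (T₀ / t) + s) * (((2 * j : ℕ) : ℝ) * t ^ (2 * j - 1)) =
      (j : ℝ) / π * (∫ t in (0 : ℝ)..T, t ^ (2 * j) * Real.log (T₀ / t)) +
        2 * (j : ℝ) * s * (∫ t in (0 : ℝ)..T, t ^ (2 * j - 1)) := by
    have e : (fun t : ℝ => (t / (2 * π) * Real.log (T₀ / t) + s) * (((2 * j : ℕ) : ℝ) * t ^ (2 * j - 1))) =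
        fun t => (j : ℝ) / π * (t ^ (2 * j) * Real.log (T₀ / t)) + 2 * (j : ℝ) * s * t ^ (2 * j - 1) := by
      funext t; exact hdom_eq t
    rw [e, intervalIntegral.integral_add ((hcont2.intervalIntegrable _ _).const_mul _)
      ((continuous_pow _).intervalIntegrable _ _ |>.const_mul _),
      intervalIntegral.integral_const_mul, intervalIntegral.integral_const_mul]
  rw [e1]
  have hI1 := integral_pow_mul_log_div_le hT₀ hT hTT₀ (show 1 ≤ 2 * j by omega)
  have hI2 : ∫ t in (0 : ℝ)..T, t ^ (2 * j - 1) = T ^ (2 * j) / (2 * (j : ℝ)) := by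
    rw [integral_pow]
    have e2 : 2 * j - 1 + 1 = 2 * j := by omega
    rw [e2]
    have : 2 * j ≠ 0 := by omega
    rw [zero_pow this, sub_zero]
    congr 1
    have : ((2 * j - 1 : ℕ) : ℝ) = 2 * (j : ℝ) - 1 := by
      rw [Nat.cast_sub (by omega)]; push_cast; ring
    rw [this]; ring
  rw [hI2]
  have hj0 : (0 : ℝ) < j := by exact_mod_cast (by omega : 0 < j)
  have hA : (j : ℝ) / π * (∫ t in (0 : ℝ)..T, t ^ (2 * j) * Real.log (T₀ / t)) ≤
      (j : ℝ) * T₀ ^ (2 * j + 1) / (π * (2 * (j : ℝ) + 1) ^ 2) := by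
    have h := mul_le_mul_of_nonneg_left hI1 (by positivity : (0 : ℝ) ≤ (j : ℝ) / π)
    refine h.trans (le_of_eq ?_)
    push_cast
    field_simp
  have hB : 2 * (j : ℝ) * s * (T ^ (2 * j) / (2 * (j : ℝ))) = s * T ^ (2 * j) := by
    field_simp
  rw [hB]
  linarith

/-- **The cumulant bound from counting** (ATTEMPT-16 Lemma B3, kernel form): under the clean horizon (`N ≤ Λ_K` on `[0,T]`) and the
counting bound of the deficit, for every `j ≥ 1`, `‖S_j‖ ≤ j·T₀^{2j+1}/(π(2j+1)²) + s·T^{2j} + j·W^{j−1}·(T+¼)·K`, `W = T² + ¼`, `K = N(T)`.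
[this track, ATTEMPT-16 §3 Lemma B3; ATTEMPT-19 §3] -/
theorem norm_dodgerPowerSum_le_counting {b T T₀ s : ℝ} (hb : 0 < b) (hT : 0 ≤ T) (hK : π * (zetaZeroCount T) / b ≤ T)
    (hΔ : ∀ t ∈ Set.Icc 0 T, (zetaZeroCount t : ℝ) - ((min ⌊b * t / π⌋₊ (zetaZeroCount T) : ℕ) : ℝ) ≤ 0)
    (hT₀ : 0 < T₀) (hTT₀ : T ≤ T₀)
    (hcount : ∀ t ∈ Set.Icc 0 T, ((min ⌊b * t / π⌋₊ (zetaZeroCount T) : ℕ) : ℝ) - (zetaZeroCount t : ℝ) ≤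
      t / (2 * π) * Real.log (T₀ / t) + s)
    {j : ℕ} (hj : 1 ≤ j) :
    ‖dodgerPowerSum b T j‖ ≤
      (j : ℝ) * T₀ ^ (2 * j + 1) / (π * (2 * (j : ℝ) + 1) ^ 2) + s * T ^ (2 * j) +
        (j : ℝ) * (T ^ 2 + 1 / 4) ^ (j - 1) * (T + 1 / 4) * (zetaZeroCount T : ℝ) := by
  set S0j := (∑ ρ ∈ zerosBetween 0 T, (riemannZetaZeroOrder ρ : ℝ) * ρ.im ^ (2 * j)) -
    ∑ k ∈ Finset.range (zetaZeroCount T), (π * ((k + 1 : ℕ) : ℝ) / b) ^ (2 * j) with hS0j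
  have hdiff := norm_dodgerPowerSum_sub_le b T j
  have h0 : 0 ≤ S0j := ordinatePowerSum_nonneg hb hT hK hΔ hj
  have hle : S0j ≤ (j : ℝ) * T₀ ^ (2 * j + 1) / (π * (2 * (j : ℝ) + 1) ^ 2) + s * T ^ (2 * j) :=
    ordinatePowerSum_le_counting hb hT hK hT₀ hTT₀ hcount hj
  have hn : ‖((S0j : ℝ) : ℂ)‖ = S0j := by rw [Complex.norm_real, Real.norm_eq_abs, abs_of_nonneg h0]
  calc ‖dodgerPowerSum b T j‖ = ‖(dodgerPowerSum b T j - ((S0j : ℝ) : ℂ)) + ((S0j : ℝ) : ℂ)‖ := by rw [sub_add_cancel]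
    _ ≤ ‖dodgerPowerSum b T j - ((S0j : ℝ) : ℂ)‖ + ‖((S0j : ℝ) : ℂ)‖ := norm_add_le _ _
    _ ≤ (j : ℝ) * (T ^ 2 + 1 / 4) ^ (j - 1) * (T + 1 / 4) * (zetaZeroCount T : ℝ) + S0j := add_le_add hdiff hn.le
    _ ≤ _ := by linarith

end Summit.RiemannHypothesis.RiemannHypothesis.Theorems.Handoff

end
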